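import Mathlib
import Summits.Ventures.PercRepro2.Defs
import Summits.Ventures.PercRepro2.Independence
import Summits.Ventures.PercRepro2.Harris
import Summits.Ventures.PercRepro2.Graph
import Summits.Ventures.PercRepro2.Exploration
import Summits.Ventures.PercRepro2.Events
import Summits.Ventures.PercRepro2.FourFunctions
import Summits.Ventures.PercRepro2.Induced
import Summits.Ventures.PercRepro2.Frontier
import Summits.Ventures.PercRepro2.ObsIndependence
import Summits.Ventures.PercRepro2.BHK
import Summits.Ventures.PercRepro2.BHKEvents
import Summits.Ventures.PercRepro2.VdBKahn
import Summits.Ventures.PercRepro2.BHKAvoid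
import Summits.Ventures.PercRepro2.R2PrimeThreeReduction
import Summits.Ventures.PercRepro2.YBridge
import Summits.Ventures.PercRepro2.Yu1Functionals
import Summits.Ventures.PercRepro2.Yu1Events
import Summits.Ventures.PercRepro2.Yu1
import Summits.Ventures.PercRepro2.LBSplit
import Summits.Ventures.PercRepro2.YDelta
import Summits.Ventures.PercRepro2.SD
import Summits.Ventures.PercRepro2.Threshold
import Summits.Ventures.PercRepro2.Lambda
import Summits.Ventures.PercRepro2.LambdaTau
import Summits.Ventures.PercRepro2.LambdaSlack
import Summits.Ventures.PercRepro2.HF2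
import Summits.Ventures.PercRepro2.Yu2
import Summits.Ventures.PercRepro2.N0
import Summits.Ventures.PercRepro2.Y
import Summits.Ventures.PercRepro2.YDeltaTools
import Summits.Ventures.PercRepro2.ZDelta
import Summits.Ventures.PercRepro2.ZExpand
import Summits.Ventures.PercRepro2.ISplit
import Summits.Ventures.PercRepro2.MRl

/-!
# The `o`-location identity of (ZΔ) (blind cell PercRepro2, typer-1; lead g7 ADDENDUM 17 (13)(1))

With `Q = {a₁ ↮ a₂}` (`avoidAll a₂ {a₁}`), `D_out = P(PD, o ∉ C₁ ∪ C₂)`, the heavy-`o` `Q`-margin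
`M_Q^{oH} = P(Q, oH, bH) − P(Q, oH, bL)` and the `o`-outside part of `W`,
`(W)_out = P(R, out, bH) − P(T, out, bL)`:

  **`Z = D · [M_Q^{oH} + (W)_out] − D_out · W`**   (`Z_oloc_identity`)

— "(ZΔ) says the heavy-`o` labelling margin covers the deficit of the `o`-outside world"; the
`o ∈ C₁` world is gone from the crux.  `Q = R ⊔ T′` (`prob_R_add_Tp`) and `PD_eq_Q_inter` are the
splits used.  Also `MRl_nonneg_of_order` (the lead's theorem MRl in the `ISplit` vocabulary) and
`PieceINonneg_of_AL_le`.
-/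

namespace Summit.Ventures.PercRepro2

open UnionCluster Yu1

namespace ZOloc

section Defs

variable {V : Type*} {E : Type*} [Fintype E] [DecidableEq E] [DecidableEq V] {R : Type*} [Field R]

/-- `M_Q^{oH} = P(Q, o ∈ C₂, b ∈ C₂) − P(Q, o ∈ C₂, b ∈ C₁)`. -/
noncomputable def MQoH (p : E → R) (ends : E → Sym2 V) (o a₁ a₂ b : V) : R :=
  prob p (avoidAll ends a₂ {a₁} ∩ connEvent ends a₂ o ∩ connEvent ends a₂ b) -
    prob p (avoidAll ends a₂ {a₁} ∩ connEvent ends a₂ o ∩ connEvent ends a₁ b)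

/-- `(W)_out = P(R, out, b ∈ C₂) − P(T, out, b ∈ C₁)`, `out = {o ∉ C₁ ∪ C₂}`. -/
noncomputable def Wout (p : E → R) (ends : E → Sym2 V) (o a₁ a₂ a₃ b : V) : R :=
  prob p (avoidAll ends a₁ {a₂, a₃} ∩ (connEvent ends a₁ o)ᶜ ∩ (connEvent ends a₂ o)ᶜ ∩
      connEvent ends a₂ b) -
    prob p (TEvent ends a₁ a₂ a₃ ∩ (connEvent ends a₁ o)ᶜ ∩ (connEvent ends a₂ o)ᶜ ∩
      connEvent ends a₁ b)

end Defs

section Splits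

variable {V : Type*} {E : Type*} [Fintype E] [DecidableEq E] [Fintype V] [DecidableEq V]
  {R : Type*} [Field R] [LinearOrder R] [IsStrictOrderedRing R]

omit [Fintype E] [DecidableEq E] [Fintype V] in
/-- `R = Q ∩ {a₃ ∉ C₁}`. -/
lemma R_eq_Q_inter (ends : E → Sym2 V) (a₁ a₂ a₃ : V) :
    avoidAll ends a₁ {a₂, a₃} = avoidAll ends a₂ {a₁} ∩ (connEvent ends a₁ a₃)ᶜ := by
  ext ω
  simp only [avoidAll, Set.mem_setOf_eq, Finset.mem_insert, Finset.mem_singleton, forall_eq_or_imp,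
    forall_eq, Set.mem_inter_iff, Set.mem_compl_iff, mem_connEvent]
  have h12 : Conn ends ω a₂ a₁ ↔ Conn ends ω a₁ a₂ := ⟨conn_symm, conn_symm⟩
  tauto

omit [Fintype E] [DecidableEq E] [Fintype V] [DecidableEq V] in
/-- `T′ = Q ∩ {a₃ ∈ C₁}`. -/
lemma Tp_eq_Q_inter (ends : E → Sym2 V) (a₁ a₂ a₃ : V) :
    TEvent ends a₂ a₁ a₃ = avoidAll ends a₂ {a₁} ∩ connEvent ends a₁ a₃ := by
  ext ω
  simp only [TEvent, Set.mem_inter_iff, Set.mem_compl_iff, mem_connEvent, avoidAll,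
    Set.mem_setOf_eq, Finset.mem_singleton, forall_eq]
  have h12 : Conn ends ω a₂ a₁ ↔ Conn ends ω a₁ a₂ := ⟨conn_symm, conn_symm⟩
  tauto

omit [Fintype V] [LinearOrder R] [IsStrictOrderedRing R] in
/-- **`Q = R ⊔ T′`** on any event `X`: `P(R ∩ X) + P(T′ ∩ X) = P(Q ∩ X)`. -/
lemma prob_R_add_Tp (p : E → R) (ends : E → Sym2 V) (a₁ a₂ a₃ : V) (X : Set (Config E)) :
    prob p (avoidAll ends a₁ {a₂, a₃} ∩ X) + prob p (TEvent ends a₂ a₁ a₃ ∩ X) =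
      prob p (avoidAll ends a₂ {a₁} ∩ X) := by
  have h := prob_inter_add_prob_inter_compl p (avoidAll ends a₂ {a₁} ∩ X) (connEvent ends a₁ a₃)
  rw [R_eq_Q_inter, Tp_eq_Q_inter]
  have e1 : avoidAll ends a₂ {a₁} ∩ (connEvent ends a₁ a₃)ᶜ ∩ X =
      avoidAll ends a₂ {a₁} ∩ X ∩ (connEvent ends a₁ a₃)ᶜ := by
    ext ω; simp only [Set.mem_inter_iff]; tauto
  have e2 : avoidAll ends a₂ {a₁} ∩ connEvent ends a₁ a₃ ∩ X =
      avoidAll ends a₂ {a₁} ∩ X ∩ connEvent ends a₁ a₃ := by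
    ext ω; simp only [Set.mem_inter_iff]; tauto
  rw [e1, e2]
  linear_combination h

end Splits

section Identity

variable {V : Type*} {E : Type*} [Fintype E] [DecidableEq E] [Fintype V] [DecidableEq V]
  {R : Type*} [Field R] [LinearOrder R] [IsStrictOrderedRing R]

omit [Fintype V] [LinearOrder R] [IsStrictOrderedRing R] in
/-- `W − (W)_out = [P(R, oL, bH) + P(R, oH, bH)] − [P(T, oL, bL) + P(T, oH, bL)]`
(the `o`-location split of the two masses of `W`, `o`-locations disjoint on `R`). -/
lemma W_sub_Wout (p : E → R) (ends : E → Sym2 V) (o a₁ a₂ a₃ b : V) :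
    (massM2 p ends a₁ a₂ a₃ b + deltaT p ends a₁ a₂ a₃ b) - Wout p ends o a₁ a₂ a₃ b =
      (prob p (avoidAll ends a₁ {a₂, a₃} ∩ connEvent ends a₁ o ∩ connEvent ends a₂ b) +
          prob p (avoidAll ends a₁ {a₂, a₃} ∩ connEvent ends a₂ o ∩ connEvent ends a₂ b)) -
        (prob p (TEvent ends a₁ a₂ a₃ ∩ connEvent ends a₁ o ∩ connEvent ends a₁ b) +
          prob p (TEvent ends a₁ a₂ a₃ ∩ connEvent ends a₂ o ∩ connEvent ends a₁ b)) := by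
  have hW : massM2 p ends a₁ a₂ a₃ b + deltaT p ends a₁ a₂ a₃ b =
      prob p (avoidAll ends a₁ {a₂, a₃} ∩ connEvent ends a₂ b) -
        prob p (TEvent ends a₁ a₂ a₃ ∩ connEvent ends a₁ b) := by
    have hN := Nh_eq p ends a₁ a₂ a₃ b
    unfold deltaT
    rw [Set.inter_comm (avoidAll ends a₁ {a₂, a₃}) (connEvent ends a₂ b),
      Set.inter_comm (TEvent ends a₁ a₂ a₃) (connEvent ends a₁ b)]
    linear_combination -hN
  -- `o`-location splits of `P(R, bH)` and `P(T, bL)` (on `R` the locations `oL`, `oH` are disjoint)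
  have s1 := prob_inter_add_prob_inter_compl p (avoidAll ends a₁ {a₂, a₃} ∩ connEvent ends a₂ b)
    (connEvent ends a₁ o)
  have s2 := prob_inter_add_prob_inter_compl p
    (avoidAll ends a₁ {a₂, a₃} ∩ connEvent ends a₂ b ∩ (connEvent ends a₁ o)ᶜ) (connEvent ends a₂ o)
  have s3 := prob_inter_add_prob_inter_compl p (TEvent ends a₁ a₂ a₃ ∩ connEvent ends a₁ b)
    (connEvent ends a₁ o)
  have s4 := prob_inter_add_prob_inter_compl p
    (TEvent ends a₁ a₂ a₃ ∩ connEvent ends a₁ b ∩ (connEvent ends a₁ o)ᶜ) (connEvent ends a₂ o)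
  have e1 : avoidAll ends a₁ {a₂, a₃} ∩ connEvent ends a₂ b ∩ connEvent ends a₁ o =
      avoidAll ends a₁ {a₂, a₃} ∩ connEvent ends a₁ o ∩ connEvent ends a₂ b := by
    ext ω; simp only [Set.mem_inter_iff]; tauto
  have e2 : avoidAll ends a₁ {a₂, a₃} ∩ connEvent ends a₂ b ∩ (connEvent ends a₁ o)ᶜ ∩
      connEvent ends a₂ o = avoidAll ends a₁ {a₂, a₃} ∩ connEvent ends a₂ o ∩ connEvent ends a₂ b := by
    ext ω
    simp only [Set.mem_inter_iff, Set.mem_compl_iff, mem_connEvent, avoidAll, Set.mem_setOf_eq,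
      Finset.mem_insert, Finset.mem_singleton, forall_eq_or_imp, forall_eq]
    have h : Conn ends ω a₂ o → Conn ends ω a₁ o → Conn ends ω a₁ a₂ :=
      fun h2 h1 => conn_trans h1 (conn_symm h2)
    tauto
  have e3 : avoidAll ends a₁ {a₂, a₃} ∩ connEvent ends a₂ b ∩ (connEvent ends a₁ o)ᶜ ∩
      (connEvent ends a₂ o)ᶜ =
      avoidAll ends a₁ {a₂, a₃} ∩ (connEvent ends a₁ o)ᶜ ∩ (connEvent ends a₂ o)ᶜ ∩
        connEvent ends a₂ b := by
    ext ω; simp only [Set.mem_inter_iff]; tauto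
  have e4 : TEvent ends a₁ a₂ a₃ ∩ connEvent ends a₁ b ∩ connEvent ends a₁ o =
      TEvent ends a₁ a₂ a₃ ∩ connEvent ends a₁ o ∩ connEvent ends a₁ b := by
    ext ω; simp only [Set.mem_inter_iff]; tauto
  have e5 : TEvent ends a₁ a₂ a₃ ∩ connEvent ends a₁ b ∩ (connEvent ends a₁ o)ᶜ ∩
      connEvent ends a₂ o = TEvent ends a₁ a₂ a₃ ∩ connEvent ends a₂ o ∩ connEvent ends a₁ b := by
    ext ω
    simp only [Set.mem_inter_iff, Set.mem_compl_iff, mem_connEvent, TEvent]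
    have h : Conn ends ω a₂ o → Conn ends ω a₁ o → Conn ends ω a₂ a₁ :=
      fun h2 h1 => conn_trans h2 (conn_symm h1)
    tauto
  have e6 : TEvent ends a₁ a₂ a₃ ∩ connEvent ends a₁ b ∩ (connEvent ends a₁ o)ᶜ ∩
      (connEvent ends a₂ o)ᶜ =
      TEvent ends a₁ a₂ a₃ ∩ (connEvent ends a₁ o)ᶜ ∩ (connEvent ends a₂ o)ᶜ ∩ connEvent ends a₁ b := by
    ext ω; simp only [Set.mem_inter_iff]; tauto
  rw [e1] at s1
  rw [e2, e3] at s2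
  rw [e4] at s3
  rw [e5, e6] at s4
  unfold Wout
  rw [hW]
  linear_combination -s1 - s2 + s3 + s4

omit [Fintype V] [LinearOrder R] [IsStrictOrderedRing R] in
/-- `M_Q^{oH} = [P(R, oH, bH) + P(T′, oH, bH)] − [P(PD, oH, bL) + P(T, oH, bL) + P(T′, oH, bL)]`
(`Q = R ⊔ T′`, `R = PD ⊔ T`). -/
lemma MQoH_split (p : E → R) (ends : E → Sym2 V) (o a₁ a₂ a₃ b : V) :
    MQoH p ends o a₁ a₂ b =
      (prob p (avoidAll ends a₁ {a₂, a₃} ∩ connEvent ends a₂ o ∩ connEvent ends a₂ b) +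
          prob p (TEvent ends a₂ a₁ a₃ ∩ connEvent ends a₂ o ∩ connEvent ends a₂ b)) -
        (prob p (PDEvent ends a₁ a₂ a₃ ∩ connEvent ends a₂ o ∩ connEvent ends a₁ b) +
          prob p (TEvent ends a₁ a₂ a₃ ∩ connEvent ends a₂ o ∩ connEvent ends a₁ b) +
          prob p (TEvent ends a₂ a₁ a₃ ∩ connEvent ends a₂ o ∩ connEvent ends a₁ b)) := by
  have q1 := prob_R_add_Tp p ends a₁ a₂ a₃ (connEvent ends a₂ o ∩ connEvent ends a₂ b)
  have q2 := prob_R_add_Tp p ends a₁ a₂ a₃ (connEvent ends a₂ o ∩ connEvent ends a₁ b)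
  have r2 := ISplit.prob_PD_add_T p ends a₁ a₂ a₃ (connEvent ends a₂ o ∩ connEvent ends a₁ b)
  simp only [← Set.inter_assoc] at q1 q2 r2
  unfold MQoH
  linear_combination -q1 + q2 + r2

omit [Fintype V] [LinearOrder R] [IsStrictOrderedRing R] in
/-- **The `o`-location identity** (ADDENDUM 17 (13)(1)):
`Z = D · [M_Q^{oH} + (W)_out] − D_out · W`. -/
theorem Z_oloc_identity (p : E → R) (ends : E → Sym2 V) (o a₁ a₂ a₃ b : V) :
    (prob p (PDEvent ends a₁ a₂ a₃ ∩ connEvent ends a₁ o) +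
          prob p (PDEvent ends a₁ a₂ a₃ ∩ connEvent ends a₂ o)) *
        (massM2 p ends a₁ a₂ a₃ b + deltaT p ends a₁ a₂ a₃ b) -
      ((prob p (PDEvent ends a₁ a₂ a₃ ∩ connEvent ends a₁ o ∩ connEvent ends a₂ b) -
            deltaL p ends o a₁ a₂ a₃ b) +
          (prob p (PDEvent ends a₁ a₂ a₃ ∩ connEvent ends a₂ o ∩ connEvent ends a₁ b) -
            deltaH p ends o a₁ a₂ a₃ b)) * prob p (PDEvent ends a₁ a₂ a₃) =
      prob p (PDEvent ends a₁ a₂ a₃) * (MQoH p ends o a₁ a₂ b + Wout p ends o a₁ a₂ a₃ b) -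
        ISplit.Dout p ends o a₁ a₂ a₃ * (massM2 p ends a₁ a₂ a₃ b + deltaT p ends a₁ a₂ a₃ b) := by
  have hD := ISplit.D_split p ends o a₁ a₂ a₃
  have hW := W_sub_Wout p ends o a₁ a₂ a₃ b
  have hM := MQoH_split p ends o a₁ a₂ a₃ b
  -- `P(R, oL, bH) = T_{l→h} + P(T, oL, bH)`
  have r1 := ISplit.prob_PD_add_T p ends a₁ a₂ a₃ (connEvent ends a₁ o ∩ connEvent ends a₂ b)
  simp only [← Set.inter_assoc] at r1
  unfold deltaL deltaH
  linear_combination (prob p (PDEvent ends a₁ a₂ a₃)) * hW - (prob p (PDEvent ends a₁ a₂ a₃)) * hM -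
    (prob p (PDEvent ends a₁ a₂ a₃)) * r1 -
    (massM2 p ends a₁ a₂ a₃ b + deltaT p ends a₁ a₂ a₃ b) * hD

end Identity

section MRlLink

variable {V : Type*} {E : Type*} [Fintype E] [DecidableEq E] [Fintype V] [DecidableEq V]
  {R : Type*} [Field R] [LinearOrder R] [IsStrictOrderedRing R]

/-- **`MRl ≥ 0`** in the `ISplit` vocabulary (the lead's THEOREM MRl, `mrl_cleared`, ADDENDUM 17
(14)(c)): under the labelling, the `oL`-share of the `R`-margin is at most `g_l`. -/
theorem MRl_nonneg_of_order (p : E → R) (hp : IsProbVec p) (ends : E → Sym2 V) {o a₁ a₂ a₃ b : V}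
    (hord : prob p (connEvent ends a₁ b) ≤ prob p (connEvent ends a₂ b)) :
    0 ≤ ISplit.MRl p ends o a₁ a₂ a₃ b := by
  unfold ISplit.MRl ISplit.MR ISplit.MRoL
  have h := mrl_cleared p hp ends (o := o) (a₃ := a₃) hord
  linarith

omit [Fintype V] in
/-- Row `(I) ≥ 0` from `AL ≤ MRl`; in particular `(I) ≥ 0` whenever `AL ≤ 0` (the BHK slack `MRl`
is load-bearing exactly when `AL > 0`, ADDENDUM 17 (14)(d)). -/
theorem PieceINonneg_of_AL_le (p : E → R) (ends : E → Sym2 V) {o a₁ a₂ a₃ b : V}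
    (h : ISplit.AL p ends o a₁ a₂ a₃ b ≤ ISplit.MRl p ends o a₁ a₂ a₃ b) :
    ISplit.PieceINonneg p ends o a₁ a₂ a₃ b := by
  unfold ISplit.PieceINonneg ISplit.PieceI
  linarith

end MRlLink

end ZOloc

end Summit.Ventures.PercRepro2
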